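import Literature.Analysis.FluidPDE.NSWeakProductRuleSobolev
import Literature.Analysis.FluidPDE.SobolevSixBall
import Literature.Analysis.FunctionSpaces.SobolevTraceDensityProofs
import HarnessLib

/-!
# Slice tools for Jia–Šverák's Lemma 8: the critical coupling term `⟪De(w), w⟫` integrated by
# parts onto `w`, and its `L⁵`–Gagliardo–Nirenberg bound

Analysis/FluidPDE support file (theorems only, no definitions, no named facts) for the discharge
of the named fact `Literature.Analysis.FluidPDE.jia_sverak_2013_lemma_8` (H. Jia, V. Šverák,
SIAM J. Math. Anal. 45 (2013) = arXiv:1201.1592, **Lemma 8**, p. 7: the uniform initial layer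
`‖u(·,t) - e^{Δt}u₀‖_{L²(B₁(x₀))} ≤ h(t)` of local Leray solutions with data bounded in `L³`;
the printed proof "omit[s] the routine calculations"). The discharge compares the local Leray
solution `u` with the free evolution `e = e^{tΔ}u₀` of the **same** datum and runs the local
energy inequality of the remainder `w = u - e` (`caloric_remainder_energy_inequality_raw`,
`CaloricRemainderRawCoupling.lean`). In that inequality the only term which is not controlled by
the a priori bounds of Jia–Šverák's Cor. 1 and by elementary heat-kernel estimates is the
coupling `-2∫∫ φ ⟪De(w), w⟫` (`‖De(t)‖_∞ ≲ t⁻¹` is not integrable at `t = 0` for `L³` data).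
This file supplies the two slice-wise facts that handle it:

* `setIntegral_mul_inner_fderiv_apply_self_eq` — **integration by parts onto `w`** on a ball
  `B`: for `w ∈ L²(B)` with weak derivative `g ∈ L²(B)` and `tr g = 0` (i.e. `div w = 0`), a
  smooth field `ε` and a scalar test function `ζ` supported in `B`,
  `∫ ζ ⟪Dε(w), w⟫ = -∫ (Dζ w) ⟪ε, w⟫ - ∫ ζ ⟪g(w), ε⟫`
  (the tree's `W^{1,2}` product rule `setIntegral_inner_fderiv_apply_self_eq_neg_of_sq`,
  Gilbarg–Trudinger (7.18), tested with the field `ζ ε`);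
* `two_mul_abs_integral_sq_mul_inner_apply_le` — **the trilinear bound**: with `χ` a smooth
  cut-off supported in `B = B(x₀, ρ)`, `|χ| ≤ 1`, `‖Dχ‖ ≤ c₁`, and `ε ∈ L⁵`,
  `2|∫ χ² ⟪g(w), ε⟫| ≤ ∫ χ²|g|² + ∫ χ²|w|² + c₁² ∫_B |w|² + K₀ ‖ε‖₅⁵ ∫ χ²|w|²`
  with `K₀ = K₀(ρ)` (Hölder `∫ |g||χw||ε|χ ≤ ‖χg‖₂ ‖χw‖₂^{2/5} ‖χw‖₆^{3/5} ‖ε‖₅`, the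
  Sobolev inequality on the ball `B(x₀,2)` with a centre-independent constant,
  `exists_eLpNorm_six_le_ball_uniform`, and the weighted arithmetic–geometric mean inequality with
  weights `(1/2, 3/10, 1/5)`). Integrated in time against the Gronwall weight
  `K₀ ‖e^{tΔ}u₀‖₅⁵ ∈ L¹(0, ∞)` (Giga's estimate, `HeatFlowGigaL5.lean`), this is the step that
  replaces the smallness assumption of the weak–strong uniqueness theorem (Lemarié-Rieusset 2016,
  Thm. 14.7) in the large-data initial-layer estimate (Seregin–Šverák 2017, proof of (1.7); ESS
  2003, Lemma 7.1 for the `L₅` class of the free flow).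

## Mathlib / tree search

Tree: `setIntegral_inner_fderiv_apply_self_eq_neg_of_sq` (`NSWeakProductRuleSobolev.lean`),
`exists_eLpNorm_six_le_ball_uniform` (`SobolevSixBall.lean`), `FunctionSpaces.hasWeakFDerivOn_smul`,
`FunctionSpaces.HasWeakFDerivOn.mono_set_holds`, `frobeniusNormSq`, `norm_apply_sq_le_frobeniusNormSq`.
Mathlib: `ENNReal.lintegral_mul_le_Lp_mul_Lq`, `ENNReal.lintegral_mul_norm_pow_le`,
`Real.geom_mean_le_arith_mean3_weighted`, `fderiv_smul`.

## References

* H. Jia, V. Šverák, SIAM J. Math. Anal. 45 (2013) 1448–1459 = arXiv:1201.1592, Lemma 8 (p. 7).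
  [JiaSverak2013]
* G. Seregin, V. Šverák, Nonlinear Anal. 154 (2017) 269–296 = arXiv:1601.03096, §1, (1.7) and
  its proof (the energy estimate of `u - e^{tΔ}u₀` for large `L³` data). [SereginSverak2017]
* P. G. Lemarié-Rieusset, *The Navier–Stokes problem in the 21st century* (2016), Thm. 14.7,
  proof pp. 515–518. [LemarieRieusset2016]
* D. Gilbarg, N. S. Trudinger, *Elliptic PDE of second order* (2001), §7.3 (7.18).
  [GilbargTrudinger2001]
-/

noncomputable section

open MeasureTheory TopologicalSpace Set Function Metric Filter
open scoped InnerProductSpace RealInnerProductSpace ENNReal NNReal Topology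

namespace Literature.Analysis.FluidPDE

open FunctionSpaces

/-! ## Integration by parts of the critical coupling onto `w` -/

section IBP

variable {x₀ : (EuclideanSpace ℝ (Fin 3))} {ρ : ℝ} {w : (EuclideanSpace ℝ (Fin 3)) → (EuclideanSpace ℝ (Fin 3))} {g : (EuclideanSpace ℝ (Fin 3)) → (EuclideanSpace ℝ (Fin 3)) →L[ℝ] (EuclideanSpace ℝ (Fin 3))}

/-- A continuous function is bounded on a ball of `(EuclideanSpace ℝ (Fin 3))` by a nonnegative constant (closed balls
are compact). [folklore] -/
theorem exists_forall_mem_ball_norm_le {F : Type*} [NormedAddCommGroup F] {f : (EuclideanSpace ℝ (Fin 3)) → F}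
    (hf : Continuous f) (x₀ : (EuclideanSpace ℝ (Fin 3))) (ρ : ℝ) : ∃ C : ℝ, 0 ≤ C ∧ ∀ x ∈ ball x₀ ρ, ‖f x‖ ≤ C := by
  obtain ⟨C, hC⟩ := (isCompact_closedBall x₀ ρ).exists_bound_of_continuousOn hf.continuousOn
  exact ⟨max C 0, le_max_right _ _, fun x hx => (hC x (ball_subset_closedBall hx)).trans (le_max_left _ _)⟩

/-- Measurability of `x ↦ L(x) (f x)` for a.e.-strongly measurable `L : X → E →L[ℝ] F` and
`f : X → E`. [folklore] -/
theorem aestronglyMeasurable_clm_apply₂ {X E F : Type*} [MeasurableSpace X] {μ : Measure X}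
    [NormedAddCommGroup E] [NormedSpace ℝ E] [NormedAddCommGroup F] [NormedSpace ℝ F]
    {L : X → E →L[ℝ] F} {f : X → E} (hL : AEStronglyMeasurable L μ)
    (hf : AEStronglyMeasurable f μ) : AEStronglyMeasurable (fun x => L x (f x)) μ :=
  ((isBoundedBilinearMap_apply (𝕜 := ℝ) (E := E) (F := F)).continuous.comp_aestronglyMeasurable
    (hL.prodMk hf) :)

/-- **Integration by parts of `ζ ⟪Dε(w), w⟫` onto `w`** (the `W^{1,2}` product rule
`∫ ⟪w, (w·∇)ψ⟫ = -∫ ⟪(∇w) w, ψ⟫`, Gilbarg–Trudinger (7.18) / Evans §5.2.3 Thm. 1 (iv), tested with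
the field `ψ = ζ ε`): for `w ∈ L²(B)` with weak derivative `g ∈ L²(B)` on the ball
`B = B(x₀, ρ)` and `tr g = 0` a.e. on `B` (`div w = 0`), a smooth field `ε` and a scalar test
function `ζ` supported in `B`,
`∫_B ζ ⟪Dε(w), w⟫ = -∫_B (Dζ w) ⟪ε, w⟫ - ∫_B ζ ⟪g(w), ε⟫`.
This is the form in which the coupling term `⟪De(w), w⟫` of the remainder `w = u - e^{tΔ}u₀`
is controlled for `L³` data (Seregin–Šverák 2017, proof of (1.7)). [cite: GilbargTrudinger2001, §7.3 (7.18)] -/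
theorem setIntegral_mul_inner_fderiv_apply_self_eq
    (hw : HasWeakFDerivOn (⟨ball x₀ ρ, isOpen_ball⟩ : Opens (EuclideanSpace ℝ (Fin 3))) volume w g)
    (hw2 : ∫⁻ x in ball x₀ ρ, ‖w x‖ₑ ^ 2 < ∞) (hg2 : ∫⁻ x in ball x₀ ρ, ‖g x‖ₑ ^ 2 < ∞)
    (htr : ∀ᵐ x ∂(volume.restrict (ball x₀ ρ)), ∑ j, g x (EuclideanSpace.single j (1 : ℝ)) j = 0)
    {ε : (EuclideanSpace ℝ (Fin 3)) → (EuclideanSpace ℝ (Fin 3))} (hε : ContDiff ℝ (⊤ : ℕ∞) ε)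
    {ζ : (EuclideanSpace ℝ (Fin 3)) → ℝ} (hζ : IsTestFunctionOn (⟨ball x₀ ρ, isOpen_ball⟩ : Opens (EuclideanSpace ℝ (Fin 3))) ζ) :
    ∫ x in ball x₀ ρ, ζ x * ⟪fderiv ℝ ε x (w x), w x⟫ =
      -(∫ x in ball x₀ ρ, fderiv ℝ ζ x (w x) * ⟪ε x, w x⟫) -
        ∫ x in ball x₀ ρ, ζ x * ⟪g x (w x), ε x⟫ := by
  set B : Set (EuclideanSpace ℝ (Fin 3)) := ball x₀ ρ with hB
  have hBm : MeasurableSet B := measurableSet_ball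
  -- the test field `ζ ε`
  have hψ : IsTestFunctionOn (⟨ball x₀ ρ, isOpen_ball⟩ : Opens (EuclideanSpace ℝ (Fin 3))) (fun x => ζ x • ε x) :=
    ⟨hζ.contDiff.smul hε, hζ.hasCompactSupport.smul_right (f' := ε),
      (tsupport_smul_subset_left ζ ε).trans hζ.tsupport_subset⟩
  have key := setIntegral_inner_fderiv_apply_self_eq_neg_of_sq hw hw2 hg2 htr hψ
  -- derivatives of `ζ ε`
  have hζd : Differentiable ℝ ζ := hζ.contDiff.differentiable (by simp)
  have hεd : Differentiable ℝ ε := hε.differentiable (by simp)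
  have hDψ : ∀ x, fderiv ℝ (fun y => ζ y • ε y) x (w x) =
      fderiv ℝ ζ x (w x) • ε x + ζ x • fderiv ℝ ε x (w x) := fun x => by
    rw [fderiv_fun_smul (hζd x) (hεd x)]
    simp only [_root_.add_apply, _root_.FunLike.coe_smul, Pi.smul_apply,
      ContinuousLinearMap.smulRight_apply]
    rw [add_comm]
  -- bounds on `B`
  obtain ⟨Cε, hCε0, hCε⟩ := exists_forall_mem_ball_norm_le hε.continuous x₀ ρ
  obtain ⟨CDε, hCDε0, hCDε⟩ := exists_forall_mem_ball_norm_le (hε.continuous_fderiv (by simp)) x₀ ρ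
  obtain ⟨Cζ, hCζ⟩ := hζ.contDiff.continuous.bounded_above_of_compact_support hζ.hasCompactSupport
  obtain ⟨CDζ, hCDζ⟩ := (hζ.contDiff.continuous_fderiv (by simp)).bounded_above_of_compact_support
    (hζ.hasCompactSupport.fderiv (𝕜 := ℝ))
  have hCζ0 : 0 ≤ Cζ := (norm_nonneg _).trans (hCζ x₀)
  have hCDζ0 : 0 ≤ CDζ := (norm_nonneg _).trans (hCDζ x₀)
  -- measurability and `|w|² ∈ L¹(B)`
  have hwm : AEStronglyMeasurable w (volume.restrict B) := hw.locallyIntegrableOn.aestronglyMeasurable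
  have hgm : AEStronglyMeasurable g (volume.restrict B) :=
    hw.locallyIntegrableOn_deriv.aestronglyMeasurable
  have hw2i : IntegrableOn (fun x => ‖w x‖ ^ 2) B volume := by
    have hm : MemLp w 2 (volume.restrict B) := by
      refine ⟨hwm, ?_⟩
      rw [eLpNorm_lt_top_iff_lintegral_rpow_enorm_lt_top two_ne_zero ENNReal.ofNat_ne_top]
      simp only [ENNReal.toReal_ofNat, ENNReal.rpow_ofNat]
      exact hw2
    exact hm.integrable_norm_pow two_ne_zero
  have hg2i : IntegrableOn (fun x => ‖g x‖ ^ 2) B volume := by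
    have hm : MemLp g 2 (volume.restrict B) := by
      refine ⟨hgm, ?_⟩
      rw [eLpNorm_lt_top_iff_lintegral_rpow_enorm_lt_top two_ne_zero ENNReal.ofNat_ne_top]
      simp only [ENNReal.toReal_ofNat, ENNReal.rpow_ofNat]
      exact hg2
    exact hm.integrable_norm_pow two_ne_zero
  have hgwi : IntegrableOn (fun x => ‖g x‖ * ‖w x‖) B volume :=
    integrable_norm_mul_norm_of_sq (μ := volume.restrict B) hgm hwm hg2i hw2i
  -- the three integrands are integrable on `B`
  have i1 : IntegrableOn (fun x => fderiv ℝ ζ x (w x) * ⟪ε x, w x⟫) B volume := by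
    refine Integrable.mono' (hw2i.const_mul (CDζ * Cε))
      ((aestronglyMeasurable_clm_apply₂
        (hζ.contDiff.continuous_fderiv (by simp)).aestronglyMeasurable hwm).mul
        (hε.continuous.aestronglyMeasurable.inner hwm)) ?_
    refine (ae_restrict_iff' hBm).2 (Eventually.of_forall fun x hx => ?_)
    rw [norm_mul]
    calc ‖fderiv ℝ ζ x (w x)‖ * ‖⟪ε x, w x⟫‖
        ≤ (CDζ * ‖w x‖) * (Cε * ‖w x‖) :=
          mul_le_mul ((ContinuousLinearMap.le_opNorm _ _).trans
            (mul_le_mul_of_nonneg_right (hCDζ x) (norm_nonneg _)))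
            ((norm_inner_le_norm _ _).trans (mul_le_mul_of_nonneg_right (hCε x hx) (norm_nonneg _)))
            (norm_nonneg _) (by positivity)
      _ = CDζ * Cε * ‖w x‖ ^ 2 := by ring
  have i2 : IntegrableOn (fun x => ζ x * ⟪fderiv ℝ ε x (w x), w x⟫) B volume := by
    refine Integrable.mono' (hw2i.const_mul (Cζ * CDε))
      (hζ.contDiff.continuous.aestronglyMeasurable.mul
        ((aestronglyMeasurable_clm_apply₂ (hε.continuous_fderiv (by simp)).aestronglyMeasurable
          hwm).inner hwm)) ?_
    refine (ae_restrict_iff' hBm).2 (Eventually.of_forall fun x hx => ?_)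
    rw [norm_mul]
    calc ‖ζ x‖ * ‖⟪fderiv ℝ ε x (w x), w x⟫‖
        ≤ Cζ * ((CDε * ‖w x‖) * ‖w x‖) :=
          mul_le_mul (hCζ x) ((norm_inner_le_norm _ _).trans (mul_le_mul_of_nonneg_right
            ((ContinuousLinearMap.le_opNorm _ _).trans (mul_le_mul_of_nonneg_right (hCDε x hx)
            (norm_nonneg _))) (norm_nonneg _))) (norm_nonneg _) hCζ0
      _ = Cζ * CDε * ‖w x‖ ^ 2 := by ring
  have i3 : IntegrableOn (fun x => ζ x * ⟪g x (w x), ε x⟫) B volume := by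
    refine Integrable.mono' (hgwi.const_mul (Cζ * Cε))
      (hζ.contDiff.continuous.aestronglyMeasurable.mul
        ((aestronglyMeasurable_clm_apply₂ hgm hwm).inner hε.continuous.aestronglyMeasurable)) ?_
    refine (ae_restrict_iff' hBm).2 (Eventually.of_forall fun x hx => ?_)
    rw [norm_mul]
    calc ‖ζ x‖ * ‖⟪g x (w x), ε x⟫‖
        ≤ Cζ * ((‖g x‖ * ‖w x‖) * Cε) :=
          mul_le_mul (hCζ x) ((norm_inner_le_norm _ _).trans (mul_le_mul
            (ContinuousLinearMap.le_opNorm _ _) (hCε x hx) (norm_nonneg _) (by positivity)))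
            (norm_nonneg _) hCζ0
      _ = Cζ * Cε * (‖g x‖ * ‖w x‖) := by ring
  -- rewrite the two sides of the product rule
  have hL : ∫ x in B, ⟪w x, fderiv ℝ (fun y => ζ y • ε y) x (w x)⟫ =
      (∫ x in B, fderiv ℝ ζ x (w x) * ⟪ε x, w x⟫) + ∫ x in B, ζ x * ⟪fderiv ℝ ε x (w x), w x⟫ := by
    rw [← integral_add i1 i2]
    refine integral_congr_ae (Eventually.of_forall fun x => ?_)
    simp only [hDψ, inner_add_right, inner_smul_right, real_inner_comm (w x)]
  have hR : ∫ x in B, ⟪g x (w x), ζ x • ε x⟫ = ∫ x in B, ζ x * ⟪g x (w x), ε x⟫ := by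
    refine integral_congr_ae (Eventually.of_forall fun x => ?_)
    simp only [inner_smul_right]
  rw [hL, hR] at key
  linarith

end IBP

/-! ## Pointwise Frobenius tools -/

section Frobenius

/-- `‖L v‖ ≤ √|L|² ‖v‖`: the operator norm is dominated by the Frobenius norm. [folklore] -/
theorem norm_clm_apply_le_sqrt_frobeniusNormSq_mul_norm (L : (EuclideanSpace ℝ (Fin 3)) →L[ℝ] (EuclideanSpace ℝ (Fin 3))) (v : (EuclideanSpace ℝ (Fin 3))) :
    ‖L v‖ ≤ Real.sqrt (frobeniusNormSq L) * ‖v‖ := by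
  have h1 : ‖L v‖ ≤ ‖L‖ * ‖v‖ := L.le_opNorm v
  have h2 : ‖L‖ ≤ Real.sqrt (frobeniusNormSq L) := by
    rw [← Real.sqrt_sq (norm_nonneg L)]
    exact Real.sqrt_le_sqrt (sq_opNorm_le_sum_sq_norm_apply (stdOrthonormalBasis ℝ (EuclideanSpace ℝ (Fin 3))) L)
  exact h1.trans (mul_le_mul_of_nonneg_right h2 (norm_nonneg _))

/-- `|A + B|² ≤ 2|A|² + 2|B|²` for the Frobenius norm. [folklore] -/
theorem frobeniusNormSq_add_le_two_mul (A B : (EuclideanSpace ℝ (Fin 3)) →L[ℝ] (EuclideanSpace ℝ (Fin 3))) :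
    frobeniusNormSq (A + B) ≤ 2 * frobeniusNormSq A + 2 * frobeniusNormSq B := by
  unfold frobeniusNormSq
  rw [Finset.mul_sum, Finset.mul_sum, ← Finset.sum_add_distrib]
  refine Finset.sum_le_sum fun i _ => ?_
  rw [_root_.add_apply]
  have h := norm_add_le (A (stdOrthonormalBasis ℝ (EuclideanSpace ℝ (Fin 3)) i)) (B (stdOrthonormalBasis ℝ (EuclideanSpace ℝ (Fin 3)) i))
  have h' := pow_le_pow_left₀ (norm_nonneg _) h 2
  nlinarith [sq_nonneg (‖A (stdOrthonormalBasis ℝ (EuclideanSpace ℝ (Fin 3)) i)‖ - ‖B (stdOrthonormalBasis ℝ (EuclideanSpace ℝ (Fin 3)) i)‖), h']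

/-- `|c A|² = c² |A|²`. [folklore] -/
theorem frobeniusNormSq_smul_eq (c : ℝ) (A : (EuclideanSpace ℝ (Fin 3)) →L[ℝ] (EuclideanSpace ℝ (Fin 3))) :
    frobeniusNormSq (c • A) = c ^ 2 * frobeniusNormSq A := by
  unfold frobeniusNormSq
  rw [Finset.mul_sum]
  refine Finset.sum_congr rfl fun i _ => ?_
  rw [_root_.FunLike.coe_smul, Pi.smul_apply, norm_smul, mul_pow, Real.norm_eq_abs, sq_abs]

/-- `|f ⊗ z|² ≤ 3 ‖f‖² |z|²` for the rank-one map `v ↦ f(v) z` on `(EuclideanSpace ℝ (Fin 3))`. [folklore] -/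
theorem frobeniusNormSq_smulRight_le_three (f : (EuclideanSpace ℝ (Fin 3)) →L[ℝ] ℝ) (z : (EuclideanSpace ℝ (Fin 3))) :
    frobeniusNormSq (f.smulRight z) ≤ 3 * ‖f‖ ^ 2 * ‖z‖ ^ 2 := by
  unfold frobeniusNormSq
  have hterm : ∀ i, ‖(f.smulRight z) (stdOrthonormalBasis ℝ (EuclideanSpace ℝ (Fin 3)) i)‖ ^ 2 ≤ ‖f‖ ^ 2 * ‖z‖ ^ 2 := by
    intro i
    rw [ContinuousLinearMap.smulRight_apply, norm_smul, mul_pow]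
    refine mul_le_mul_of_nonneg_right (pow_le_pow_left₀ (norm_nonneg _) ?_ 2) (sq_nonneg _)
    calc ‖f (stdOrthonormalBasis ℝ (EuclideanSpace ℝ (Fin 3)) i)‖ ≤ ‖f‖ * ‖stdOrthonormalBasis ℝ (EuclideanSpace ℝ (Fin 3)) i‖ := f.le_opNorm _
      _ = ‖f‖ := by rw [(stdOrthonormalBasis ℝ (EuclideanSpace ℝ (Fin 3))).orthonormal.1 i, mul_one]
  calc ∑ i, ‖(f.smulRight z) (stdOrthonormalBasis ℝ (EuclideanSpace ℝ (Fin 3)) i)‖ ^ 2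
      ≤ ∑ _i : Fin (Module.finrank ℝ (EuclideanSpace ℝ (Fin 3))), ‖f‖ ^ 2 * ‖z‖ ^ 2 := Finset.sum_le_sum fun i _ => hterm i
    _ = 3 * ‖f‖ ^ 2 * ‖z‖ ^ 2 := by
        rw [Finset.sum_const, Finset.card_univ, Fintype.card_fin, finrank_euclideanSpace_fin,
          nsmul_eq_mul]
        push_cast
        ring

/-- The Leibniz gradient of `χ w`: `|χ g + Dχ ⊗ w|² ≤ 2χ²|g|² + 6‖Dχ‖²|w|²`. [folklore] -/
theorem frobeniusNormSq_smul_add_smulRight_le_six (c : ℝ) (A : (EuclideanSpace ℝ (Fin 3)) →L[ℝ] (EuclideanSpace ℝ (Fin 3))) (f : (EuclideanSpace ℝ (Fin 3)) →L[ℝ] ℝ)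
    (z : (EuclideanSpace ℝ (Fin 3))) :
    frobeniusNormSq (c • A + f.smulRight z) ≤ 2 * (c ^ 2 * frobeniusNormSq A) + 6 * ‖f‖ ^ 2 * ‖z‖ ^ 2 := by
  have h1 := frobeniusNormSq_add_le_two_mul (c • A) (f.smulRight z)
  have h2 := frobeniusNormSq_smulRight_le_three f z
  rw [frobeniusNormSq_smul_eq] at h1
  linarith

/-- The pointwise form of the trilinear bound: `|χ² ⟪g(w), ε⟫| ≤ (|χ| √|g|²) (‖χ w‖ ‖ε‖)`.
[folklore] -/
theorem abs_sq_mul_inner_apply_le (χ : ℝ) (g : (EuclideanSpace ℝ (Fin 3)) →L[ℝ] (EuclideanSpace ℝ (Fin 3))) (w ε : (EuclideanSpace ℝ (Fin 3))) :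
    |χ ^ 2 * ⟪g w, ε⟫| ≤ (|χ| * Real.sqrt (frobeniusNormSq g)) * (‖χ • w‖ * ‖ε‖) := by
  have h1 : χ ^ 2 * ⟪g w, ε⟫ = χ * ⟪g (χ • w), ε⟫ := by
    rw [map_smul, inner_smul_left]; simp; ring
  rw [h1, abs_mul]
  have h2 : |⟪g (χ • w), ε⟫| ≤ Real.sqrt (frobeniusNormSq g) * ‖χ • w‖ * ‖ε‖ :=
    (abs_real_inner_le_norm _ _).trans (mul_le_mul_of_nonneg_right
      (norm_clm_apply_le_sqrt_frobeniusNormSq_mul_norm g _) (norm_nonneg _))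
  calc |χ| * |⟪g (χ • w), ε⟫| ≤ |χ| * (Real.sqrt (frobeniusNormSq g) * ‖χ • w‖ * ‖ε‖) :=
        mul_le_mul_of_nonneg_left h2 (abs_nonneg _)
    _ = _ := by ring

/-- Young: `x y ≤ x²/4 + y²`. [folklore] -/
private theorem mul_le_sq_div_four_add_sq (x y : ℝ) : x * y ≤ x ^ 2 / 4 + y ^ 2 := by
  nlinarith [sq_nonneg (x / 2 - y)]

end Frobenius

/-! ## Hölder with weights `(2/5, 1/5, 2/5)` -/

section Holder

variable {α : Type*} [MeasurableSpace α] {μ : Measure α}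

/-- The pointwise splitting `b² c² = (b²)^{2/5} · ((b⁶)^{1/3} (c⁵)^{2/3})^{3/5}` in `ℝ≥0∞`.
[folklore] -/
theorem sq_mul_sq_eq_rpow_split (b c : ℝ≥0∞) :
    b ^ 2 * c ^ 2 =
      (b ^ 2) ^ (2 / 5 : ℝ) * ((b ^ 6) ^ (1 / 3 : ℝ) * (c ^ 5) ^ (2 / 3 : ℝ)) ^ (3 / 5 : ℝ) := by
  have e1 : (b ^ 2) ^ (2 / 5 : ℝ) = b ^ (4 / 5 : ℝ) := by
    rw [← ENNReal.rpow_two, ← ENNReal.rpow_mul]; norm_num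
  have e2 : (b ^ 6) ^ (1 / 3 : ℝ) = b ^ (2 : ℝ) := by
    rw [← ENNReal.rpow_natCast, ← ENNReal.rpow_mul]; norm_num
  have e3 : (c ^ 5) ^ (2 / 3 : ℝ) = c ^ (10 / 3 : ℝ) := by
    rw [← ENNReal.rpow_natCast, ← ENNReal.rpow_mul]; norm_num
  have e4 : (b ^ (2 : ℝ) * c ^ (10 / 3 : ℝ)) ^ (3 / 5 : ℝ) = b ^ (6 / 5 : ℝ) * c ^ (2 : ℝ) := by
    rw [ENNReal.mul_rpow_of_nonneg _ _ (by norm_num), ← ENNReal.rpow_mul, ← ENNReal.rpow_mul]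
    norm_num
  rw [e1, e2, e3, e4, ← mul_assoc, ← ENNReal.rpow_add_of_nonneg _ _ (by norm_num) (by norm_num),
    ENNReal.rpow_two, ← ENNReal.rpow_two b]
  norm_num

/-- **Hölder with the three weights `2/5, 1/5, 2/5`**:
`∫ b² c² ≤ (∫ b²)^{2/5} (∫ b⁶)^{1/5·3} … ` in the form
`∫ b² c² ≤ (∫ b²)^{2/5} ((∫ b⁶)^{1/3} (∫ c⁵)^{2/3})^{3/5}` (i.e. `‖bc‖₂ ≤ ‖b‖₂^{2/5}‖b‖₆^{3/5}‖c‖₅`,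
the interpolation `L² ∩ L⁶ ⊂ L^{10/3}` paired with `L⁵`). [folklore] -/
theorem lintegral_sq_mul_sq_le (b c : α → ℝ≥0∞) (hb : AEMeasurable b μ) (hc : AEMeasurable c μ) :
    ∫⁻ x, b x ^ 2 * c x ^ 2 ∂μ ≤
      (∫⁻ x, b x ^ 2 ∂μ) ^ (2 / 5 : ℝ) *
        ((∫⁻ x, b x ^ 6 ∂μ) ^ (1 / 3 : ℝ) * (∫⁻ x, c x ^ 5 ∂μ) ^ (2 / 3 : ℝ)) ^ (3 / 5 : ℝ) := by
  set H : α → ℝ≥0∞ := fun x => (b x ^ 6) ^ (1 / 3 : ℝ) * (c x ^ 5) ^ (2 / 3 : ℝ) with hH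
  have hHm : AEMeasurable H μ :=
    ((hb.pow_const _).pow_const _).mul ((hc.pow_const _).pow_const _)
  have h1 : ∫⁻ x, b x ^ 2 * c x ^ 2 ∂μ = ∫⁻ x, (b x ^ 2) ^ (2 / 5 : ℝ) * H x ^ (3 / 5 : ℝ) ∂μ :=
    lintegral_congr fun x => sq_mul_sq_eq_rpow_split (b x) (c x)
  have h2 : ∫⁻ x, (b x ^ 2) ^ (2 / 5 : ℝ) * H x ^ (3 / 5 : ℝ) ∂μ ≤
      (∫⁻ x, b x ^ 2 ∂μ) ^ (2 / 5 : ℝ) * (∫⁻ x, H x ∂μ) ^ (3 / 5 : ℝ) :=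
    ENNReal.lintegral_mul_norm_pow_le (hb.pow_const _) hHm (by norm_num) (by norm_num) (by norm_num)
  have h3 : ∫⁻ x, H x ∂μ ≤ (∫⁻ x, b x ^ 6 ∂μ) ^ (1 / 3 : ℝ) * (∫⁻ x, c x ^ 5 ∂μ) ^ (2 / 3 : ℝ) :=
    ENNReal.lintegral_mul_norm_pow_le (hb.pow_const _) (hc.pow_const _) (by norm_num) (by norm_num)
      (by norm_num)
  rw [h1]
  refine h2.trans ?_
  gcongr

end Holder

/-! ## The trilinear bound -/

section Trilinear

/-- `(t²)^{3/5} = t^{6/5} = (t³)^{2/5}` for `t ≥ 0`: the scalings of the weighted AM–GM step are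
chosen so that no irrational constant appears. [folklore] -/
theorem rpow_sq_three_fifths_eq (t : ℝ) (ht : 0 ≤ t) :
    (t ^ 2) ^ (3 / 5 : ℝ) = (t ^ 3) ^ (2 / 5 : ℝ) := by
  rw [← Real.rpow_natCast t 2, ← Real.rpow_natCast t 3, ← Real.rpow_mul ht, ← Real.rpow_mul ht]
  norm_num

set_option maxHeartbeats 1600000 in
/-- **The trilinear bound for the critical coupling** (the step of Jia–Šverák's Lemma 8 /
Seregin–Šverák 2017 (1.7) that replaces the smallness of the weak–strong uniqueness theorem): there
is, for every radius `ρ`, a constant `K₀ = K₀(ρ) ≥ 0` such that for every ball `B = B(x₀, ρ)`, every `w ∈ L²(B)` with weak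
derivative `g` on `B`, `∫_B |g|² < ∞`, every smooth cut-off `χ` supported in `B` with `|χ| ≤ 1`,
`‖Dχ‖ ≤ c₁`, and every continuous `ε ∈ L⁵((EuclideanSpace ℝ (Fin 3)))`,
`2 |∫ χ² ⟪g(w), ε⟫| ≤ ∫ χ² |g|² + ∫ χ² |w|² + c₁² ∫_B |w|² + K₀ ‖ε‖₅⁵ ∫ χ² |w|²`.
Proof: `|χ²⟪g(w), ε⟫| ≤ (|χ|√|g|²)(|χw||ε|) ≤ ¼χ²|g|² + |χw|²|ε|²`; Hölder
`∫ |χw|²|ε|² ≤ ‖χw‖₂^{4/5} ‖χw‖₆^{6/5} ‖ε‖₅²` (`lintegral_sq_mul_sq_le`); the Sobolev inequality on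
`B(x₀, ρ)` with a centre-independent constant `C_S` (`exists_eLpNorm_six_le_ball_uniform`) for
`χw`, whose weak derivative is `χ g + Dχ ⊗ w`, so `‖χw‖₆² ≤ 2C²(‖χw‖₂² + 2∫χ²|g|² + 6c₁²∫_B|w|²)`,
`C = C_S + 1`; and the weighted AM–GM inequality `m^{3/5}(yp)^{2/5} ≤ (3/5) m/(16C²) + (2/5) 64C³ yp`.
`K₀ = 52 C³`. [cite: JiaSverak2013, Lemma 8 (arXiv:1201.1592 p. 7)] [cite: SereginSverak2017, §1 (1.7) and its proof] -/
theorem two_mul_abs_integral_sq_mul_inner_apply_le (ρ : ℝ) :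
    ∃ K₀ : ℝ, 0 ≤ K₀ ∧ ∀ (x₀ : (EuclideanSpace ℝ (Fin 3))) (w : (EuclideanSpace ℝ (Fin 3)) → (EuclideanSpace ℝ (Fin 3))) (g : (EuclideanSpace ℝ (Fin 3)) → (EuclideanSpace ℝ (Fin 3)) →L[ℝ] (EuclideanSpace ℝ (Fin 3))) (χ : (EuclideanSpace ℝ (Fin 3)) → ℝ) (c₁ : ℝ)
      (ε : (EuclideanSpace ℝ (Fin 3)) → (EuclideanSpace ℝ (Fin 3))),
      HasWeakFDerivOn (⟨ball x₀ ρ, isOpen_ball⟩ : Opens (EuclideanSpace ℝ (Fin 3))) volume w g →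
      ∫⁻ x in ball x₀ ρ, ‖w x‖ₑ ^ 2 < ∞ →
      ∫⁻ x in ball x₀ ρ, ENNReal.ofReal (frobeniusNormSq (g x)) < ∞ →
      ContDiff ℝ (⊤ : ℕ∞) χ → tsupport χ ⊆ ball x₀ ρ → (∀ x, |χ x| ≤ 1) → 0 ≤ c₁ →
      (∀ x, ‖fderiv ℝ χ x‖ ≤ c₁) → Continuous ε → eLpNorm ε 5 volume < ∞ →
      2 * |∫ x, χ x ^ 2 * ⟪g x (w x), ε x⟫| ≤
        (∫ x, χ x ^ 2 * frobeniusNormSq (g x)) + (∫ x, χ x ^ 2 * ‖w x‖ ^ 2) +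
          c₁ ^ 2 * (∫ x in ball x₀ ρ, ‖w x‖ ^ 2) +
          K₀ * (eLpNorm ε 5 volume).toReal ^ 5 * ∫ x, χ x ^ 2 * ‖w x‖ ^ 2 := by
  obtain ⟨CS, hCS⟩ := exists_eLpNorm_six_le_ball_uniform (E := (EuclideanSpace ℝ (Fin 3))) finrank_euclideanSpace_fin ρ
  set C : ℝ := (CS : ℝ) + 1 with hC
  have hC0 : 0 < C := by have := CS.coe_nonneg; rw [hC]; linarith
  have hCS_le : (CS : ℝ) ≤ C := by rw [hC]; linarith
  refine ⟨52 * C ^ 3, by positivity, ?_⟩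
  intro x₀ w g χ c₁ ε hw hw2 hg2 hχ hχB hχ1 hc₁ hDχ hεc hε5
  set B : Set (EuclideanSpace ℝ (Fin 3)) := ball x₀ ρ with hB
  have hBm : MeasurableSet B := measurableSet_ball
  set μB : Measure (EuclideanSpace ℝ (Fin 3)) := volume.restrict B with hμB
  haveI hfin : IsFiniteMeasure μB := ⟨by rw [hμB, Measure.restrict_apply_univ]; exact measure_ball_lt_top⟩
  -- `χ` vanishes off `B`
  have hχ0 : ∀ x, x ∉ B → χ x = 0 := fun x hx =>
    image_eq_zero_of_notMem_tsupport fun h => hx (hχB h)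
  have hχc : Continuous χ := hχ.continuous
  have hDχc : Continuous (fderiv ℝ χ) := hχ.continuous_fderiv (by simp)
  have hχ1' : ∀ x, χ x ^ 2 ≤ 1 := fun x => by
    have := hχ1 x; rw [← sq_abs]; nlinarith [abs_nonneg (χ x)]
  -- measurability
  have hwm : AEStronglyMeasurable w μB := hw.locallyIntegrableOn.aestronglyMeasurable
  have hgm : AEStronglyMeasurable g μB := hw.locallyIntegrableOn_deriv.aestronglyMeasurable
  have hfrob_c : Continuous fun L : (EuclideanSpace ℝ (Fin 3)) →L[ℝ] (EuclideanSpace ℝ (Fin 3)) => frobeniusNormSq L := by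
    unfold frobeniusNormSq
    exact continuous_finsetSum _ fun i _ =>
      ((ContinuousLinearMap.apply ℝ (EuclideanSpace ℝ (Fin 3)) (stdOrthonormalBasis ℝ (EuclideanSpace ℝ (Fin 3)) i)).continuous.norm).pow 2
  have hfrobm : AEStronglyMeasurable (fun x => frobeniusNormSq (g x)) μB :=
    hfrob_c.comp_aestronglyMeasurable hgm
  -- ### the cut-off field `f = χ w` and its Leibniz gradient
  set f : (EuclideanSpace ℝ (Fin 3)) → (EuclideanSpace ℝ (Fin 3)) := fun x => χ x • w x with hf
  set g' : (EuclideanSpace ℝ (Fin 3)) → (EuclideanSpace ℝ (Fin 3)) →L[ℝ] (EuclideanSpace ℝ (Fin 3)) := fun x => χ x • g x + (fderiv ℝ χ x).smulRight (w x) with hg'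
  have hfg' : HasWeakFDerivOn (⟨ball x₀ ρ, isOpen_ball⟩ : Opens (EuclideanSpace ℝ (Fin 3))) volume f g' :=
    SobolevApprox.hasWeakFDerivOn_smul hw hχ
  have hfm : AEStronglyMeasurable f μB := hχc.aestronglyMeasurable.smul hwm
  have hf_le : ∀ x, ‖f x‖ ≤ ‖w x‖ := fun x => by
    rw [hf]; dsimp only; rw [norm_smul, Real.norm_eq_abs]
    exact mul_le_of_le_one_left (norm_nonneg _) (hχ1 x)
  have hf_sq : ∀ x, ‖f x‖ ^ 2 = χ x ^ 2 * ‖w x‖ ^ 2 := fun x => by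
    rw [hf]; dsimp only; rw [norm_smul, mul_pow, Real.norm_eq_abs, sq_abs]
  -- ### the `ℝ≥0∞` quantities
  set A : ℝ≥0∞ := ∫⁻ x in B, ENNReal.ofReal (χ x ^ 2 * frobeniusNormSq (g x)) with hA
  set Y : ℝ≥0∞ := ∫⁻ x in B, ‖f x‖ₑ ^ 2 with hY
  set W : ℝ≥0∞ := ∫⁻ x in B, ‖w x‖ₑ ^ 2 with hW
  set P : ℝ≥0∞ := ∫⁻ x, ‖ε x‖ₑ ^ 5 with hP
  have hAfin : A < ∞ := by
    refine lt_of_le_of_lt (lintegral_mono fun x => ENNReal.ofReal_le_ofReal ?_) hg2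
    exact mul_le_of_le_one_left (frobeniusNormSq_nonneg _) (hχ1' x)
  have hYW : Y ≤ W := lintegral_mono fun x => by
    gcongr
    rw [← ofReal_norm, ← ofReal_norm]
    exact ENNReal.ofReal_le_ofReal (hf_le x)
  have hWfin : W < ∞ := hw2
  have hYfin : Y < ∞ := lt_of_le_of_lt hYW hWfin
  have hPfin : P < ∞ := by
    have h := hε5
    rw [eLpNorm_lt_top_iff_lintegral_rpow_enorm_lt_top (by norm_num) (by norm_num)] at h
    simp only [ENNReal.toReal_ofNat, ENNReal.rpow_ofNat] at h
    exact h
  have hP_eq : (eLpNorm ε 5 volume).toReal ^ 5 = P.toReal := by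
    rw [eLpNorm_eq_lintegral_rpow_enorm_toReal (by norm_num) (by norm_num)]
    simp only [ENNReal.toReal_ofNat, ENNReal.rpow_ofNat, one_div]
    rw [← ENNReal.toReal_pow, ← ENNReal.rpow_natCast, ← ENNReal.rpow_mul,
      show ((5 : ℝ)⁻¹ * ((5 : ℕ) : ℝ)) = 1 by norm_num, ENNReal.rpow_one]
  -- ### the Sobolev inequality for `f`
  have hY2 : eLpNorm f 2 μB = Y ^ (1 / 2 : ℝ) := by
    rw [eLpNorm_eq_lintegral_rpow_enorm_toReal two_ne_zero ENNReal.ofNat_ne_top]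
    simp only [ENNReal.toReal_ofNat, ENNReal.rpow_ofNat]
    rfl
  have hY2fin : eLpNorm f 2 μB ≠ ∞ := by
    rw [hY2]; exact ENNReal.rpow_ne_top_of_nonneg (by norm_num) hYfin.ne
  set D : ℝ≥0∞ := ∫⁻ x in B, ENNReal.ofReal (frobeniusNormSq (g' x)) with hD
  have hD_le : D ≤ 2 * A + ENNReal.ofReal (6 * c₁ ^ 2) * W := by
    have hpt : ∀ x, ENNReal.ofReal (frobeniusNormSq (g' x)) ≤
        2 * ENNReal.ofReal (χ x ^ 2 * frobeniusNormSq (g x)) + ENNReal.ofReal (6 * c₁ ^ 2) * ‖w x‖ₑ ^ 2 := by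
      intro x
      have h1 := frobeniusNormSq_smul_add_smulRight_le_six (χ x) (g x) (fderiv ℝ χ x) (w x)
      have h2 : 6 * ‖fderiv ℝ χ x‖ ^ 2 * ‖w x‖ ^ 2 ≤ 6 * c₁ ^ 2 * ‖w x‖ ^ 2 := by
        have := hDχ x
        gcongr
      calc ENNReal.ofReal (frobeniusNormSq (g' x))
          ≤ ENNReal.ofReal (2 * (χ x ^ 2 * frobeniusNormSq (g x)) + 6 * c₁ ^ 2 * ‖w x‖ ^ 2) :=
            ENNReal.ofReal_le_ofReal (h1.trans (by linarith))
        _ = 2 * ENNReal.ofReal (χ x ^ 2 * frobeniusNormSq (g x)) +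
              ENNReal.ofReal (6 * c₁ ^ 2) * ‖w x‖ₑ ^ 2 := by
            rw [ENNReal.ofReal_add (mul_nonneg zero_le_two (mul_nonneg (sq_nonneg _) (frobeniusNormSq_nonneg _)))
              (by positivity), ENNReal.ofReal_mul (p := 2) zero_le_two,
              ENNReal.ofReal_ofNat, ENNReal.ofReal_mul (p := 6 * c₁ ^ 2) (by positivity), ← ofReal_norm,
              ENNReal.ofReal_pow (norm_nonneg _)]
    calc D ≤ ∫⁻ x in B, (2 * ENNReal.ofReal (χ x ^ 2 * frobeniusNormSq (g x)) +
          ENNReal.ofReal (6 * c₁ ^ 2) * ‖w x‖ₑ ^ 2) := lintegral_mono fun x => hpt x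
      _ = 2 * A + ENNReal.ofReal (6 * c₁ ^ 2) * W := by
          have hm1 : AEMeasurable (fun x => ENNReal.ofReal (χ x ^ 2 * frobeniusNormSq (g x))) μB :=
            (((hχc.pow 2).aestronglyMeasurable.mul hfrobm).aemeasurable).ennreal_ofReal
          rw [lintegral_add_left' (hm1.const_mul _), lintegral_const_mul'' _ hm1,
            lintegral_const_mul'' _ (hwm.aemeasurable.enorm.pow_const _)]
  have hDfin : D < ∞ :=
    lt_of_le_of_lt hD_le (by
      refine ENNReal.add_lt_top.2 ⟨ENNReal.mul_lt_top (by simp) hAfin, ENNReal.mul_lt_top ENNReal.ofReal_lt_top hWfin⟩)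
  have hS6 : eLpNorm f 6 μB ≤ CS * (Y ^ (1 / 2 : ℝ) + D ^ (1 / 2 : ℝ)) := by
    have h := hCS x₀ f g' hfg' hY2fin
    rw [hY2] at h
    exact h
  have hS6fin : eLpNorm f 6 μB < ∞ := by
    refine lt_of_le_of_lt hS6 (ENNReal.mul_lt_top (by simp) (ENNReal.add_lt_top.2 ⟨?_, ?_⟩))
    · exact ENNReal.rpow_lt_top_of_nonneg (by norm_num) hYfin.ne
    · exact ENNReal.rpow_lt_top_of_nonneg (by norm_num) hDfin.ne
  -- `S = ∫ |f|⁶ = ‖f‖₆⁶`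
  set S : ℝ≥0∞ := ∫⁻ x in B, ‖f x‖ₑ ^ 6 with hS
  have hS_eq : eLpNorm f 6 μB ^ 6 = S := by
    rw [eLpNorm_eq_lintegral_rpow_enorm_toReal (by norm_num) (by norm_num)]
    simp only [ENNReal.toReal_ofNat, ENNReal.rpow_ofNat, one_div]
    rw [← ENNReal.rpow_natCast, ← ENNReal.rpow_mul,
      show ((6 : ℝ)⁻¹ * ((6 : ℕ) : ℝ)) = 1 by norm_num, ENNReal.rpow_one]
  -- ### the real quantities
  set a : ℝ := A.toReal with ha
  set y : ℝ := Y.toReal with hy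
  set w' : ℝ := W.toReal with hw'
  set p : ℝ := P.toReal with hp
  set s6 : ℝ := (eLpNorm f 6 μB).toReal with hs6
  have ha0 : 0 ≤ a := ENNReal.toReal_nonneg
  have hy0 : 0 ≤ y := ENNReal.toReal_nonneg
  have hw'0 : 0 ≤ w' := ENNReal.toReal_nonneg
  have hp0 : 0 ≤ p := ENNReal.toReal_nonneg
  have hs60 : 0 ≤ s6 := ENNReal.toReal_nonneg
  -- identification of the real integrals
  have hχ2frob_i : Integrable (fun x => χ x ^ 2 * frobeniusNormSq (g x)) μB := by
    refine ⟨(hχc.pow 2).aestronglyMeasurable.mul hfrobm, ?_⟩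
    rw [hasFiniteIntegral_iff_enorm]
    refine lt_of_le_of_lt (lintegral_mono fun x => le_of_eq ?_) hAfin
    rw [Real.enorm_eq_ofReal (mul_nonneg (sq_nonneg _) (frobeniusNormSq_nonneg _))]
  have ha_eq' : (∫ x in B, χ x ^ 2 * frobeniusNormSq (g x)) = a := by
    rw [ha, hA, integral_eq_lintegral_of_nonneg_ae
      (Eventually.of_forall fun x => mul_nonneg (sq_nonneg _) (frobeniusNormSq_nonneg _))
      hχ2frob_i.aestronglyMeasurable]
  have ha_eq : (∫ x, χ x ^ 2 * frobeniusNormSq (g x)) = a := by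
    rw [← setIntegral_eq_integral_of_forall_compl_eq_zero (s := B) (fun x hx => by
      rw [hχ0 x hx]; ring)]
    exact ha_eq'
  have hw2i : Integrable (fun x => ‖w x‖ ^ 2) μB := by
    have hm : MemLp w 2 μB := by
      refine ⟨hwm, ?_⟩
      rw [eLpNorm_lt_top_iff_lintegral_rpow_enorm_lt_top two_ne_zero ENNReal.ofNat_ne_top]
      simp only [ENNReal.toReal_ofNat, ENNReal.rpow_ofNat]
      exact hw2
    exact hm.integrable_norm_pow two_ne_zero
  have hf2i : Integrable (fun x => ‖f x‖ ^ 2) μB :=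
    Integrable.mono' hw2i (hfm.norm.pow 2) (Eventually.of_forall fun x => by
      rw [Real.norm_eq_abs, abs_of_nonneg (sq_nonneg _)]
      exact pow_le_pow_left₀ (norm_nonneg _) (hf_le x) 2)
  have hy_eq : (∫ x, χ x ^ 2 * ‖w x‖ ^ 2) = y := by
    rw [← setIntegral_eq_integral_of_forall_compl_eq_zero (s := B) (fun x hx => by
      rw [hχ0 x hx]; ring)]
    simp_rw [← hf_sq]
    rw [hy, hY, integral_eq_lintegral_of_nonneg_ae (Eventually.of_forall fun x => sq_nonneg _)
      (hfm.norm.pow 2)]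
    congr 1
    refine lintegral_congr fun x => ?_
    rw [← ofReal_norm, ENNReal.ofReal_pow (norm_nonneg _)]
  have hw'_eq : (∫ x in B, ‖w x‖ ^ 2) = w' := by
    rw [hw', hW, integral_eq_lintegral_of_nonneg_ae (Eventually.of_forall fun x => sq_nonneg _)
      (hwm.norm.pow 2)]
    congr 1
    refine lintegral_congr fun x => ?_
    rw [← ofReal_norm, ENNReal.ofReal_pow (norm_nonneg _)]
  -- ### (1) the pointwise Young splitting: `I ≤ a/4 + J`
  obtain ⟨Cε, hCε0, hCε⟩ := exists_forall_mem_ball_norm_le hεc x₀ ρ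
  have hJi : Integrable (fun x => ‖f x‖ ^ 2 * ‖ε x‖ ^ 2) μB := by
    refine Integrable.mono' (hf2i.mul_const (Cε ^ 2)) ((hfm.norm.pow 2).mul
      (hεc.aestronglyMeasurable.norm.pow 2)) ?_
    refine (ae_restrict_iff' hBm).2 (Eventually.of_forall fun x hx => ?_)
    rw [Real.norm_eq_abs, abs_of_nonneg (by positivity)]
    exact mul_le_mul_of_nonneg_left (pow_le_pow_left₀ (norm_nonneg _) (hCε x hx) 2) (sq_nonneg _)
  set J : ℝ := ∫ x in B, ‖f x‖ ^ 2 * ‖ε x‖ ^ 2 with hJ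
  have hI1 : |∫ x, χ x ^ 2 * ⟪g x (w x), ε x⟫| ≤ a / 4 + J := by
    rw [← setIntegral_eq_integral_of_forall_compl_eq_zero (s := B) (fun x hx => by
      rw [hχ0 x hx]; ring)]
    have hbound : ∀ x, |χ x ^ 2 * ⟪g x (w x), ε x⟫| ≤
        (χ x ^ 2 * frobeniusNormSq (g x)) / 4 + ‖f x‖ ^ 2 * ‖ε x‖ ^ 2 := by
      intro x
      refine (abs_sq_mul_inner_apply_le (χ x) (g x) (w x) (ε x)).trans ?_
      refine (mul_le_sq_div_four_add_sq _ _).trans (le_of_eq ?_)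
      rw [mul_pow, mul_pow, sq_abs, Real.sq_sqrt (frobeniusNormSq_nonneg _)]
    calc |∫ x in B, χ x ^ 2 * ⟪g x (w x), ε x⟫|
        ≤ ∫ x in B, |χ x ^ 2 * ⟪g x (w x), ε x⟫| := abs_integral_le_integral_abs
      _ ≤ ∫ x in B, ((χ x ^ 2 * frobeniusNormSq (g x)) / 4 + ‖f x‖ ^ 2 * ‖ε x‖ ^ 2) := by
          refine integral_mono_of_nonneg (Eventually.of_forall fun x => abs_nonneg _)
            ((hχ2frob_i.div_const 4).add hJi) (Eventually.of_forall hbound)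
      _ = a / 4 + J := by
          rw [integral_add (hχ2frob_i.div_const 4) hJi, integral_div, ha_eq']
  -- ### (2) Hölder: `J ≤ y^{2/5} (s6²)^{3/5} p^{2/5}`
  have hJ2 : J ≤ y ^ (2 / 5 : ℝ) * (s6 ^ 2) ^ (3 / 5 : ℝ) * p ^ (2 / 5 : ℝ) := by
    -- `ofReal J = ∫⁻ |f|² |ε|²`
    have hJlin : ENNReal.ofReal J = ∫⁻ x in B, ‖f x‖ₑ ^ 2 * ‖ε x‖ₑ ^ 2 := by
      rw [hJ, ofReal_integral_eq_lintegral_ofReal hJi (Eventually.of_forall fun x => by positivity)]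
      refine lintegral_congr fun x => ?_
      rw [ENNReal.ofReal_mul (sq_nonneg _), ← ofReal_norm, ← ofReal_norm (ε x),
        ENNReal.ofReal_pow (norm_nonneg _), ENNReal.ofReal_pow (norm_nonneg _)]
    have hH := lintegral_sq_mul_sq_le (μ := μB) (fun x => ‖f x‖ₑ) (fun x => ‖ε x‖ₑ)
      hfm.aemeasurable.enorm hεc.aestronglyMeasurable.aemeasurable.enorm
    have hPB : ∫⁻ x in B, ‖ε x‖ₑ ^ 5 ≤ P := by
      rw [hP]; exact setLIntegral_le_lintegral _ _
    have hH' : ∫⁻ x in B, ‖f x‖ₑ ^ 2 * ‖ε x‖ₑ ^ 2 ≤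
        Y ^ (2 / 5 : ℝ) * (S ^ (1 / 3 : ℝ) * P ^ (2 / 3 : ℝ)) ^ (3 / 5 : ℝ) := by
      refine hH.trans ?_
      gcongr
    -- pass to reals
    have hrhs_fin : Y ^ (2 / 5 : ℝ) * (S ^ (1 / 3 : ℝ) * P ^ (2 / 3 : ℝ)) ^ (3 / 5 : ℝ) ≠ ∞ := by
      have hSfin : S < ∞ := by
        rw [← hS_eq]; exact ENNReal.pow_lt_top hS6fin
      refine ENNReal.mul_ne_top (ENNReal.rpow_ne_top_of_nonneg (by norm_num) hYfin.ne)
        (ENNReal.rpow_ne_top_of_nonneg (by norm_num) (ENNReal.mul_ne_top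
          (ENNReal.rpow_ne_top_of_nonneg (by norm_num) hSfin.ne)
          (ENNReal.rpow_ne_top_of_nonneg (by norm_num) hPfin.ne)))
    have hJle : J ≤ (Y ^ (2 / 5 : ℝ) * (S ^ (1 / 3 : ℝ) * P ^ (2 / 3 : ℝ)) ^ (3 / 5 : ℝ)).toReal := by
      have h0J : 0 ≤ J := integral_nonneg fun x => by positivity
      rw [← ENNReal.ofReal_le_iff_le_toReal hrhs_fin, hJlin]
      exact hH'
    refine hJle.trans (le_of_eq ?_)
    rw [ENNReal.toReal_mul, ← ENNReal.toReal_rpow, ← ENNReal.toReal_rpow, ENNReal.toReal_mul,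
      ← ENNReal.toReal_rpow, ← ENNReal.toReal_rpow, ← hS_eq, ENNReal.toReal_pow]
    rw [← hy, ← hp, ← hs6]
    -- `(s6^6)^{1/3} = s6²`, and `(s6² p^{2/3})^{3/5} = (s6²)^{3/5} p^{2/5}`
    have e1 : (s6 ^ 6) ^ (1 / 3 : ℝ) = s6 ^ 2 := by
      rw [← Real.rpow_natCast s6 6, ← Real.rpow_mul hs60, ← Real.rpow_two s6]; norm_num
    have e2 : (p ^ (2 / 3 : ℝ)) ^ (3 / 5 : ℝ) = p ^ (2 / 5 : ℝ) := by
      rw [← Real.rpow_mul hp0]; norm_num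
    rw [e1, Real.mul_rpow (sq_nonneg _) (Real.rpow_nonneg hp0 _), e2]
    ring
  -- ### (3) Sobolev in real form: `s6² ≤ 2 C² (y + 2a + 6 c₁² w')`
  have hm_le : s6 ^ 2 ≤ 2 * C ^ 2 * (y + (2 * a + 6 * c₁ ^ 2 * w')) := by
    have hd : D.toReal ≤ 2 * a + 6 * c₁ ^ 2 * w' := by
      have hfin2 : 2 * A + ENNReal.ofReal (6 * c₁ ^ 2) * W ≠ ∞ :=
        ENNReal.add_ne_top.2 ⟨ENNReal.mul_ne_top (by simp) hAfin.ne, ENNReal.mul_ne_top ENNReal.ofReal_ne_top hWfin.ne⟩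
      calc D.toReal ≤ (2 * A + ENNReal.ofReal (6 * c₁ ^ 2) * W).toReal := ENNReal.toReal_mono hfin2 hD_le
        _ = 2 * a + 6 * c₁ ^ 2 * w' := by
            rw [ENNReal.toReal_add (ENNReal.mul_ne_top (by simp) hAfin.ne)
              (ENNReal.mul_ne_top ENNReal.ofReal_ne_top hWfin.ne), ENNReal.toReal_mul, ENNReal.toReal_mul,
              ENNReal.toReal_ofReal (by positivity)]
            simp [ha, hw']
    have hs6le : s6 ≤ C * (Real.sqrt y + Real.sqrt D.toReal) := by
      have hfin3 : (CS : ℝ≥0∞) * (Y ^ (1 / 2 : ℝ) + D ^ (1 / 2 : ℝ)) ≠ ∞ :=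
        ENNReal.mul_ne_top (by simp) (ENNReal.add_ne_top.2
          ⟨ENNReal.rpow_ne_top_of_nonneg (by norm_num) hYfin.ne,
           ENNReal.rpow_ne_top_of_nonneg (by norm_num) hDfin.ne⟩)
      calc s6 ≤ ((CS : ℝ≥0∞) * (Y ^ (1 / 2 : ℝ) + D ^ (1 / 2 : ℝ))).toReal := ENNReal.toReal_mono hfin3 hS6
        _ = CS * (Real.sqrt y + Real.sqrt D.toReal) := by
            rw [ENNReal.toReal_mul, ENNReal.toReal_add (ENNReal.rpow_ne_top_of_nonneg (by norm_num) hYfin.ne)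
              (ENNReal.rpow_ne_top_of_nonneg (by norm_num) hDfin.ne), ← ENNReal.toReal_rpow,
              ← ENNReal.toReal_rpow, Real.sqrt_eq_rpow, Real.sqrt_eq_rpow]
            simp [hy]
        _ ≤ C * (Real.sqrt y + Real.sqrt D.toReal) :=
            mul_le_mul_of_nonneg_right hCS_le (add_nonneg (Real.sqrt_nonneg _) (Real.sqrt_nonneg _))
    have hsq : (Real.sqrt y + Real.sqrt D.toReal) ^ 2 ≤ 2 * (y + (2 * a + 6 * c₁ ^ 2 * w')) := by
      have h1 : (Real.sqrt y + Real.sqrt D.toReal) ^ 2 ≤ 2 * (Real.sqrt y) ^ 2 + 2 * (Real.sqrt D.toReal) ^ 2 := by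
        nlinarith [sq_nonneg (Real.sqrt y - Real.sqrt D.toReal)]
      rw [Real.sq_sqrt hy0, Real.sq_sqrt ENNReal.toReal_nonneg] at h1
      linarith
    calc s6 ^ 2 ≤ (C * (Real.sqrt y + Real.sqrt D.toReal)) ^ 2 := pow_le_pow_left₀ hs60 hs6le 2
      _ = C ^ 2 * (Real.sqrt y + Real.sqrt D.toReal) ^ 2 := by ring
      _ ≤ C ^ 2 * (2 * (y + (2 * a + 6 * c₁ ^ 2 * w'))) := mul_le_mul_of_nonneg_left hsq (sq_nonneg _)
      _ = _ := by ring
  -- ### (4) the weighted AM–GM step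
  have hJ3 : J ≤ (3 / 40) * (y + (2 * a + 6 * c₁ ^ 2 * w')) + (128 / 5) * C ^ 3 * (y * p) := by
    set m : ℝ := s6 ^ 2 with hm
    have hm0 : 0 ≤ m := sq_nonneg _
    set t : ℝ := 4 * C with ht
    have ht0 : 0 < t := by positivity
    -- `p₁ = m / t²`, `p₂ = t³ y p`
    have hkey : y ^ (2 / 5 : ℝ) * m ^ (3 / 5 : ℝ) * p ^ (2 / 5 : ℝ) =
        (m / t ^ 2) ^ (3 / 5 : ℝ) * (t ^ 3 * (y * p)) ^ (2 / 5 : ℝ) := by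
      rw [Real.div_rpow hm0 (sq_nonneg _), Real.mul_rpow (by positivity) (mul_nonneg hy0 hp0),
        Real.mul_rpow hy0 hp0, ← rpow_sq_three_fifths_eq t ht0.le]
      have htne : (t ^ 2) ^ (3 / 5 : ℝ) ≠ 0 := (Real.rpow_pos_of_pos (by positivity) _).ne'
      field_simp
    have hamgm := Real.geom_mean_le_arith_mean2_weighted (w₁ := 3 / 5) (w₂ := 2 / 5)
      (p₁ := m / t ^ 2) (p₂ := t ^ 3 * (y * p)) (by norm_num) (by norm_num)
      (div_nonneg hm0 (sq_nonneg _)) (by positivity) (by norm_num)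
    have hJ2' : J ≤ y ^ (2 / 5 : ℝ) * m ^ (3 / 5 : ℝ) * p ^ (2 / 5 : ℝ) := hJ2
    rw [hkey] at hJ2'
    refine hJ2'.trans (hamgm.trans ?_)
    have ht2 : t ^ 2 = 16 * C ^ 2 := by rw [ht]; ring
    have ht3 : t ^ 3 = 64 * C ^ 3 := by rw [ht]; ring
    rw [ht2, ht3]
    have hC2 : 0 < 16 * C ^ 2 := by positivity
    have hX : m / (16 * C ^ 2) ≤ (y + (2 * a + 6 * c₁ ^ 2 * w')) / 8 := by
      rw [div_le_div_iff₀ hC2 (by norm_num)]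
      nlinarith [hm_le, pow_pos hC0 2]
    have hyp : 0 ≤ C ^ 3 * (y * p) := mul_nonneg (pow_pos hC0 3).le (mul_nonneg hy0 hp0)
    linarith [hX, hyp]
  -- ### (5) conclusion
  rw [ha_eq, hy_eq, hw'_eq, hP_eq]
  have hyp0 : 0 ≤ C ^ 3 * p * y := mul_nonneg (mul_nonneg (pow_pos hC0 3).le hp0) hy0
  have hcw : 0 ≤ c₁ ^ 2 * w' := mul_nonneg (sq_nonneg c₁) hw'0
  have hstep : 2 * |∫ x, χ x ^ 2 * ⟪g x (w x), ε x⟫| ≤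
      (4 / 5) * a + (3 / 20) * y + (9 / 10) * (c₁ ^ 2 * w') + (256 / 5) * (C ^ 3 * p * y) := by
    have hIJ : |∫ x, χ x ^ 2 * ⟪g x (w x), ε x⟫| ≤
        a / 4 + ((3 / 40) * (y + (2 * a + 6 * c₁ ^ 2 * w')) + (128 / 5) * C ^ 3 * (y * p)) :=
      hI1.trans (by linarith [hJ3])
    have h2 := mul_le_mul_of_nonneg_left hIJ zero_le_two
    refine h2.trans (le_of_eq ?_)
    ring
  nlinarith [hstep, ha0, hy0, hcw, hyp0]

end Trilinear

end Literature.Analysis.FluidPDE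

end
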